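import Summits.ResolutionOfSingularities.ResolutionOfSingularities.Theorems.UniversalCellsCampaignW82FrobeniusTwistProofs
import Summits.ResolutionOfSingularities.ResolutionOfSingularities.Theorems.UniversalCellsCampaignW82SmoothTwistRungs
import HarnessLib

/-!
# [OURS · L1 W8.2] The Frobenius-twist step: graded residual names, rungs (curves over any field; dimension
# ≤ 3 given F-02) and the kernel from it — proofs

Cell `res-hironaka`, LADDER-RESOLUTION rung L (RESCUE), slot W8.2, host route `UniversalCells`, host item
`PrimeFieldToPerfect` (stmt-ResolutionOfSingularities-15233); prover res-L1-s82-pv-1 (gen 2). THESES-FREE sequel of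
Theorems/UniversalCellsCampaignW82FrobeniusTwistProofs.lean (names from the statement file
Theorems/UniversalCellsCampaignW82FrobeniusTwistGraded.lean, p483512).

WHAT IS PROVED:
* `perfectionStepDimLe_iff_frobeniusTwistStepDimLe` (door 1, p469608's residual),
  `perfectionStepAlgClosedDimLe_iff_forall_frobeniusTwistStepAt` (door 2 v1, p470934),
  `perfectionStepAlgClosureFgDimLe_iff_forall_frobeniusTwistStepAt` (door 2 sharpest, p475047) — the three
  lane-signed graded residuals of slot W8.2 in the single-field Frobenius-twist form.
* `hasSmoothFrobeniusTwistModel_of_dim_le_one` — over ANY field `K` of characteristic `p`, every separated `X₀`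
  of finite type and dimension `≤ 1`, irreducible and geometrically reduced, has SOME FROBENIUS TWIST with a
  proper birational model SMOOTH over `K` — UNCONDITIONAL; `hasSmoothFrobeniusTwistModel_of_dim_le_three` — the
  same in dimension `≤ 3` given the named fact F-02 `CossartPiltant2019` (`hCP`).
* `frobeniusTwistStepAt_of_le_one` / `frobeniusTwistStepAt_of_le_three` — rungs `n ≤ 1` (unconditional) /
  `n ≤ 3` (F-02); so `n = 4` is the first open rung in this form too.
* `climbRatFuncPerfDimLe_succ_of_frobeniusTwistStep` — kernel grade `(n + 1, n)` (e.g. the headline `(5, 4)`)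
  from grade `n` of the Frobenius-twist step alone; `climbRatFuncPerfDimLe_top_top_of_frobeniusTwistStep_top` —
  the registered kernel of stmt-15233 / stmt-8933 from the Frobenius-twist step at `⊤`.
* `exists_smoothFrobeniusTwistModel_of_le`, `HasSmoothFrobeniusTwistModel.eventually` — every exponent
  `e' ≥ e` works as soon as `e` does (so the least exponent `r_F(X₀)` of STRATEGY-CENSUS.md is well defined).

HONEST FRAMING. OURS work of the rescue rung (role replaced: §17 ¶2 p.89 l.59–62 / §2 p.4 l.22–24 of
[Hironaka2017], see the statement file); NOT a statement of the manuscript; the only external premise is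
FACT-LIST F-02, as an explicit hypothesis of the `…_le_three` rungs. AI work, weaker than expert review.

## References
* V. Cossart, O. Piltant, J. Algebra 529 (2019), Thm. 1.1 — named fact F-02. [CossartPiltant2019]
-/

noncomputable section

set_option linter.dupNamespace false -- mandated namespace of this single-conjunct summit

open _root_.CategoryTheory _root_.CategoryTheory.Limits _root_.AlgebraicGeometry
open Literature.AlgebraicGeometry.Resolution

namespace Summit.ResolutionOfSingularities.ResolutionOfSingularities.Theorems.CampaignW82

/-! ## The three lane-signed graded residuals of slot W8.2, in Frobenius-twist form -/

/-- **Door 1**: `PerfectionStepDimLe p n ↔ FrobeniusTwistStepDimLe p n` at every grade. [folklore] -/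
theorem perfectionStepDimLe_iff_frobeniusTwistStepDimLe (p : ℕ) [Fact p.Prime] (n : WithBot ℕ∞) :
    PerfectionStepDimLe p n ↔ FrobeniusTwistStepDimLe p n :=
  ⟨fun h M _ _ _ => (perfectionStepAt_iff_frobeniusTwistStepAt p M n).1 (h M),
    fun h M _ _ _ => (perfectionStepAt_iff_frobeniusTwistStepAt p M n).2 (h M)⟩

/-- **Door 2, v1**: `PerfectionStepAlgClosedDimLe p n ↔ ∀ M algebraically closed of characteristic p,
FrobeniusTwistStepAt p M n`. [folklore] -/
theorem perfectionStepAlgClosedDimLe_iff_forall_frobeniusTwistStepAt (p : ℕ) [Fact p.Prime]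
    (n : WithBot ℕ∞) :
    PerfectionStepAlgClosedDimLe p n ↔
      ∀ (M : Type) [Field M] [CharP M p] [IsAlgClosed M], FrobeniusTwistStepAt p M n :=
  ⟨fun h M _ _ _ => (perfectionStepAt_iff_frobeniusTwistStepAt p M n).1 (h M),
    fun h M _ _ _ => (perfectionStepAt_iff_frobeniusTwistStepAt p M n).2 (h M)⟩

/-- **Door 2, sharpest form**: `PerfectionStepAlgClosureFgDimLe p n ↔ ∀ K s, FrobeniusTwistStepAt p
((closure s)^{alg} ∩ K) n`. [folklore] -/
theorem perfectionStepAlgClosureFgDimLe_iff_forall_frobeniusTwistStepAt (p : ℕ) [Fact p.Prime]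
    (n : WithBot ℕ∞) :
    PerfectionStepAlgClosureFgDimLe p n ↔
      ∀ (K : Type) [Field K] [CharP K p] [IsAlgClosed K] (s : Finset K),
        FrobeniusTwistStepAt p (algebraicClosure (Subfield.closure (↑s : Set K)) K) n :=
  ⟨fun h K _ _ _ s => (perfectionStepAt_iff_frobeniusTwistStepAt p _ n).1 (h K s),
    fun h K _ _ _ s => (perfectionStepAt_iff_frobeniusTwistStepAt p _ n).2 (h K s)⟩

/-! ## Rungs and the kernel -/

/-- **Smooth models of Frobenius twists of CURVES, over ANY field of characteristic `p`** (unconditional):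
for `f₀ : X₀ ⟶ Spec K` separated of finite type of dimension `≤ 1`, irreducible and geometrically reduced
(`IntegralOverPerfectClosure`), some Frobenius twist `X₀^{(p^e)}` has a proper birational model smooth over
`K`. [folklore] -/
theorem hasSmoothFrobeniusTwistModel_of_dim_le_one (p : ℕ) [Fact p.Prime] (K : Type) [Field K] [CharP K p]
    {X₀ : Scheme.{0}} (f₀ : X₀ ⟶ Spec (.of K)) [IsSeparated f₀] [LocallyOfFiniteType f₀] [QuasiCompact f₀]
    (hd : topologicalKrullDim X₀ ≤ 1) (hint : IntegralOverPerfectClosure K f₀) :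
    HasSmoothFrobeniusTwistModel p K f₀ :=
  hasSmoothFrobeniusTwistModel_of_hasSmoothModelAtFiniteLevel p K f₀
    (hasSmoothModelAtFiniteLevel_of_dim_le_one K f₀ hd hint)

/-- The same in dimension `≤ 3`, CONDITIONAL on the named fact F-02 `CossartPiltant2019` (`hCP`).
[cite: CossartPiltant2019, Thm. 1.1] -/
theorem hasSmoothFrobeniusTwistModel_of_dim_le_three (hCP : CossartPiltant2019.{0}) (p : ℕ) [Fact p.Prime]
    (K : Type) [Field K] [CharP K p] {X₀ : Scheme.{0}} (f₀ : X₀ ⟶ Spec (.of K)) [IsSeparated f₀]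
    [LocallyOfFiniteType f₀] [QuasiCompact f₀] (hd : topologicalKrullDim X₀ ≤ 3)
    (hint : IntegralOverPerfectClosure K f₀) : HasSmoothFrobeniusTwistModel p K f₀ :=
  hasSmoothFrobeniusTwistModel_of_hasSmoothModelAtFiniteLevel p K f₀
    (hasSmoothModelAtFiniteLevel_of_dim_le_three hCP K f₀ hd hint)

/-- The Frobenius-twist step, rung `n ≤ 1`, unconditional. [folklore] -/
theorem frobeniusTwistStepAt_of_le_one (p : ℕ) [Fact p.Prime] (M : Type) [Field M] [CharP M p]
    {n : WithBot ℕ∞} (hn : n ≤ 1) : FrobeniusTwistStepAt p M n :=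
  frobeniusTwistStepAt_of_smoothTwistStepAt p M (smoothTwistStepAt_of_le_one M hn)

/-- The Frobenius-twist step, rung `n ≤ 3`, conditional on F-02. [cite: CossartPiltant2019, Thm. 1.1] -/
theorem frobeniusTwistStepAt_of_le_three (hCP : CossartPiltant2019.{0}) (p : ℕ) [Fact p.Prime] (M : Type)
    [Field M] [CharP M p] {n : WithBot ℕ∞} (hn : n ≤ 3) : FrobeniusTwistStepAt p M n :=
  frobeniusTwistStepAt_of_smoothTwistStepAt p M (smoothTwistStepAt_of_le_three hCP M hn)

/-- **Kernel grade `(n + 1, n)` from the Frobenius-twist step at grade `n`** (door 1): e.g. the first open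
kernel rung `(5, 4)` of slot W8.2 is «for every perfect `M` of characteristic `p` with resolution of integral
separated schemes of finite type of dimension `≤ 4` over `M(t)`, every irreducible geometrically reduced
fourfold over `M(t)` has a Frobenius twist with a SMOOTH proper birational model over `M(t)`». [folklore] -/
theorem climbRatFuncPerfDimLe_succ_of_frobeniusTwistStep {p : ℕ} [Fact p.Prime] {n : WithBot ℕ∞}
    (h : FrobeniusTwistStepDimLe p n) : ClimbRatFuncPerfDimLe p (n + 1) n :=
  climbRatFuncPerfDimLe_succ_of_perfectionStep ((perfectionStepDimLe_iff_frobeniusTwistStepDimLe p n).2 h)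

/-- **The whole registered kernel from the Frobenius-twist step at the top grade** (door 1):
`FrobeniusTwistStepDimLe p ⊤ → ClimbRatFuncPerfDimLe p ⊤ ⊤`. [folklore] -/
theorem climbRatFuncPerfDimLe_top_top_of_frobeniusTwistStep_top {p : ℕ} [Fact p.Prime]
    (h : FrobeniusTwistStepDimLe p ⊤) : ClimbRatFuncPerfDimLe p ⊤ ⊤ :=
  climbRatFuncPerfDimLe_top_top_of_perfectionStep_top
    ((perfectionStepDimLe_iff_frobeniusTwistStepDimLe p ⊤).2 h)

/-! ## Larger twist exponents -/

/-- **Every larger exponent works**: a proper birational model of the twist `X₀^{(p^e)}` smooth over `K` gives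
one of `X₀^{(p^{e'})}` for every `e' ≥ e` (base change along `Frob^{e' - e} : K → K`,
`exists_smoothModel_baseChange`; `(x^{p^e})^{p^{e'-e}} = x^{p^{e'}}`). So the least admissible exponent — the
invariant `r_F(X₀)` of Cruxes/PrimeFieldToPerfect/STRATEGY-CENSUS.md — is well defined and all `e ≥ r_F` are
admissible. [folklore] -/
theorem exists_smoothFrobeniusTwistModel_of_le (p : ℕ) [Fact p.Prime] (K : Type) [Field K] [CharP K p]
    {X₀ : Scheme.{0}} (f₀ : X₀ ⟶ Spec (.of K)) [LocallyOfFiniteType f₀] [QuasiCompact f₀] {e e' : ℕ}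
    (he : e ≤ e') (Y : Scheme.{0})
    (π : Y ⟶ pullback f₀ (Spec.map (CommRingCat.ofHom (iterateFrobenius K p e)))) [IsProper π]
    (hbir : IsBirational π)
    [Smooth (π ≫ pullback.snd f₀ (Spec.map (CommRingCat.ofHom (iterateFrobenius K p e))))] :
    ∃ (Y' : Scheme.{0})
      (π' : Y' ⟶ pullback f₀ (Spec.map (CommRingCat.ofHom (iterateFrobenius K p e')))),
      IsProper π' ∧ IsBirational π' ∧
        Smooth (π' ≫ pullback.snd f₀ (Spec.map (CommRingCat.ofHom (iterateFrobenius K p e')))) := by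
  refine exists_smoothModel_baseChange f₀ (iterateFrobenius K p e) (iterateFrobenius K p (e' - e))
    (iterateFrobenius K p e') ?_ Y π hbir
  ext x
  simp only [RingHom.coe_comp, Function.comp_apply, iterateFrobenius_def, ← pow_mul, ← pow_add,
    Nat.add_sub_cancel' he]

/-- Hence `HasSmoothFrobeniusTwistModel p K f₀` is witnessed at every sufficiently large exponent: if it holds,
then for some `e₀` every `e ≥ e₀` carries a smooth proper birational model of `X₀^{(p^e)}`. [folklore] -/
theorem HasSmoothFrobeniusTwistModel.eventually (p : ℕ) [Fact p.Prime] (K : Type) [Field K] [CharP K p]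
    {X₀ : Scheme.{0}} (f₀ : X₀ ⟶ Spec (.of K)) [LocallyOfFiniteType f₀] [QuasiCompact f₀]
    (h : HasSmoothFrobeniusTwistModel p K f₀) :
    ∃ e₀ : ℕ, ∀ e : ℕ, e₀ ≤ e → ∃ (Y : Scheme.{0})
      (π : Y ⟶ pullback f₀ (Spec.map (CommRingCat.ofHom (iterateFrobenius K p e)))),
      IsProper π ∧ IsBirational π ∧
        Smooth (π ≫ pullback.snd f₀ (Spec.map (CommRingCat.ofHom (iterateFrobenius K p e)))) := by
  obtain ⟨e₀, Y, π, hprop, hbir, hsm⟩ := h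
  haveI := hprop
  haveI := hsm
  exact ⟨e₀, fun e he => exists_smoothFrobeniusTwistModel_of_le p K f₀ he Y π hbir⟩

/-! ## v2 (append-only): the composition law of the Frobenius-root climb

Everything above this line is byte-identical with v1 (p483971). Appended by res-L1-s82-pv-1 (gen 2). The climb
of Cruxes/PrimeFieldToPerfect/STRATEGY-CENSUS.md («resolve – take a p-th root – re-resolve …») composes: a
proper birational model `Z` of a twist `X₀^{(p^e)}` (e.g. a resolution of it, supplied by the hypothesis over
`RatFunc M`, or its normalisation) with a smooth Frobenius-twist model of exponent `e'` yields a smooth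
Frobenius-twist model of `X₀` of exponent `e + e'` — so `r_F(X₀) ≤ e + r_F(Z)`. No reducedness or regularity of
`Z` is needed. (The census's point (N2)(iii) stands: this law does not make the climb terminate; it is its
bookkeeping.) -/

/-- **Base change of a proper birational model along a further map of ground fields** (no smoothness):
for `f₀ : X₀ ⟶ Spec K` of finite type, ring maps of fields `σ : K → F`, `τ : F → F'` with `τ ∘ σ = θ`, and a
proper birational `ρ : Z ⟶ X₀ ×_{K,σ} Spec F`, the base change of `ρ` along `Spec τ` is a proper birational
`ρ' : Z ×_{F,τ} Spec F' ⟶ X₀ ×_{K,θ} Spec F'` over `Spec F'` (birational by FLAT base change,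
`Theorems.isBirational_of_isPullback_of_flat`). [folklore] -/
theorem exists_model_baseChange {K F F' : Type} [Field K] [Field F] [Field F'] {X₀ : Scheme.{0}}
    (f₀ : X₀ ⟶ Spec (.of K)) [LocallyOfFiniteType f₀] [QuasiCompact f₀] (σ : K →+* F) (τ : F →+* F')
    (θ : K →+* F') (hθ : τ.comp σ = θ)
    (Z : Scheme.{0}) (ρ : Z ⟶ pullback f₀ (Spec.map (CommRingCat.ofHom σ))) [IsProper ρ]
    (hbir : IsBirational ρ) :
    ∃ ρ' : pullback (ρ ≫ pullback.snd f₀ (Spec.map (CommRingCat.ofHom σ))) (Spec.map (CommRingCat.ofHom τ)) ⟶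
        pullback f₀ (Spec.map (CommRingCat.ofHom θ)),
      IsProper ρ' ∧ IsBirational ρ' ∧
        ρ' ≫ pullback.snd f₀ (Spec.map (CommRingCat.ofHom θ)) =
          pullback.snd (ρ ≫ pullback.snd f₀ (Spec.map (CommRingCat.ofHom σ))) (Spec.map (CommRingCat.ofHom τ)) := by
  subst hθ
  have e' : Spec.map (CommRingCat.ofHom τ) ≫ Spec.map (CommRingCat.ofHom σ) =
      Spec.map (CommRingCat.ofHom (τ.comp σ)) := by
    rw [← Spec.map_comp, ← CommRingCat.ofHom_comp]
  haveI : Flat (Spec.map (CommRingCat.ofHom τ)) := DeJong1996.Stage.flat_specMap τ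
  haveI : IsNoetherian (pullback f₀ (Spec.map (CommRingCat.ofHom σ))) :=
    Scheme.isNoetherian_of_finiteType_over_field (pullback.snd f₀ (Spec.map (CommRingCat.ofHom σ)))
  haveI : IsNoetherian Z :=
    Scheme.isNoetherian_of_finiteType_over_field (ρ ≫ pullback.snd f₀ (Spec.map (CommRingCat.ofHom σ)))
  obtain ⟨π', h₁, h₂⟩ :
      ∃ π' : pullback (ρ ≫ pullback.snd f₀ (Spec.map (CommRingCat.ofHom σ)))
          (Spec.map (CommRingCat.ofHom τ)) ⟶
        pullback (pullback.snd f₀ (Spec.map (CommRingCat.ofHom σ))) (Spec.map (CommRingCat.ofHom τ)),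
        pullback.fst (ρ ≫ pullback.snd f₀ (Spec.map (CommRingCat.ofHom σ)))
            (Spec.map (CommRingCat.ofHom τ)) ≫ ρ =
          π' ≫ pullback.fst (pullback.snd f₀ (Spec.map (CommRingCat.ofHom σ)))
            (Spec.map (CommRingCat.ofHom τ)) ∧
        π' ≫ pullback.snd (pullback.snd f₀ (Spec.map (CommRingCat.ofHom σ)))
            (Spec.map (CommRingCat.ofHom τ)) =
          pullback.snd (ρ ≫ pullback.snd f₀ (Spec.map (CommRingCat.ofHom σ)))
            (Spec.map (CommRingCat.ofHom τ)) :=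
    ⟨pullback.lift (pullback.fst _ _ ≫ ρ) (pullback.snd _ _)
      (by rw [Category.assoc, pullback.condition]),
      (pullback.lift_fst _ _ _).symm, pullback.lift_snd _ _ _⟩
  have big := IsPullback.of_hasPullback (ρ ≫ pullback.snd f₀ (Spec.map (CommRingCat.ofHom σ)))
    (Spec.map (CommRingCat.ofHom τ))
  rw [← h₂] at big
  have sq : IsPullback
      (pullback.fst (ρ ≫ pullback.snd f₀ (Spec.map (CommRingCat.ofHom σ)))
        (Spec.map (CommRingCat.ofHom τ))) π' ρ
      (pullback.fst (pullback.snd f₀ (Spec.map (CommRingCat.ofHom σ))) (Spec.map (CommRingCat.ofHom τ))) :=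
    IsPullback.of_bot big h₁ (IsPullback.of_hasPullback _ _)
  haveI : IsProper π' := MorphismProperty.of_isPullback sq ‹IsProper ρ›
  have hbir' : IsBirational π' :=
    Summit.ResolutionOfSingularities.ResolutionOfSingularities.Theorems.isBirational_of_isPullback_of_flat
      sq hbir
  let ε : pullback (pullback.snd f₀ (Spec.map (CommRingCat.ofHom σ))) (Spec.map (CommRingCat.ofHom τ)) ≅
      pullback f₀ (Spec.map (CommRingCat.ofHom (τ.comp σ))) :=
    pullbackLeftPullbackSndIso f₀ (Spec.map (CommRingCat.ofHom σ)) (Spec.map (CommRingCat.ofHom τ)) ≪≫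
      pullback.congrHom rfl e'
  have hε : ε.hom ≫ pullback.snd f₀ (Spec.map (CommRingCat.ofHom (τ.comp σ))) =
      pullback.snd (pullback.snd f₀ (Spec.map (CommRingCat.ofHom σ))) (Spec.map (CommRingCat.ofHom τ)) := by
    simp only [ε, Iso.trans_hom, Category.assoc, pullback.congrHom_hom, pullback.lift_snd,
      Category.comp_id]
    exact pullbackLeftPullbackSndIso_hom_snd _ _ _
  refine ⟨π' ≫ ε.hom, inferInstance, hbir'.comp_iso ε.hom, ?_⟩
  rw [Category.assoc, hε, h₂]

/-- **The composition law of the climb** (`r_F(X₀) ≤ e + r_F(Z)`): for `f₀ : X₀ ⟶ Spec K` of finite type over a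
field of characteristic `p` and a proper birational model `ρ : Z ⟶ X₀^{(p^e)}` of a Frobenius twist of `X₀`
(e.g. a resolution of `X₀^{(p^e)}`, or its normalisation), a smooth Frobenius-twist model of `Z` (as a
`K`-scheme through `X₀^{(p^e)} ⟶ Spec K`) of exponent `e'` yields a smooth Frobenius-twist model of `X₀` of
exponent `e + e'`: twist `ρ` by `Frob^{e'}` (`exists_model_baseChange`, `(x^{p^e})^{p^{e'}} = x^{p^{e+e'}}`) and
compose (`IsBirational.comp`). [folklore] -/
theorem hasSmoothFrobeniusTwistModel_of_model_of_twist (p : ℕ) [Fact p.Prime] (K : Type) [Field K]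
    [CharP K p] {X₀ Z : Scheme.{0}} (f₀ : X₀ ⟶ Spec (.of K)) [LocallyOfFiniteType f₀] [QuasiCompact f₀]
    (e : ℕ) (ρ : Z ⟶ pullback f₀ (Spec.map (CommRingCat.ofHom (iterateFrobenius K p e)))) [IsProper ρ]
    (hρ : IsBirational ρ)
    (hZ : HasSmoothFrobeniusTwistModel p K
      (ρ ≫ pullback.snd f₀ (Spec.map (CommRingCat.ofHom (iterateFrobenius K p e))))) :
    HasSmoothFrobeniusTwistModel p K f₀ := by
  obtain ⟨e', Y, π, hprop, hbir, hsm⟩ := hZ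
  haveI := hprop
  haveI := hsm
  have hcomp : (iterateFrobenius K p e').comp (iterateFrobenius K p e) = iterateFrobenius K p (e + e') := by
    ext x
    simp only [RingHom.coe_comp, Function.comp_apply, iterateFrobenius_def, ← pow_mul, ← pow_add]
  obtain ⟨ρ', h₁, h₂, h₃⟩ :=
    exists_model_baseChange f₀ (iterateFrobenius K p e) (iterateFrobenius K p e') (iterateFrobenius K p (e + e'))
      hcomp Z ρ hρ
  haveI := h₁
  refine ⟨e + e', Y, π ≫ ρ', inferInstance, hbir.comp h₂, ?_⟩
  rw [Category.assoc, h₃]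
  exact hsm

end Summit.ResolutionOfSingularities.ResolutionOfSingularities.Theorems.CampaignW82

end
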